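import Mathlib.Algebra.Homology.HomologicalComplexAbelian
import Mathlib.Algebra.Homology.HomologySequence
import Mathlib.Algebra.Homology.ShortComplex.ModuleCat
import Mathlib.Data.ZMod.Basic
import Literature.AlgebraicTopology.SingularHomology.SingularChainsConcrete
import HarnessLib

/-!
# Change of coefficients on concrete singular chains and the integral Bockstein criterion

Topic `Literature/AlgebraicTopology/SingularHomology`. For the concrete singular chain complex
`Literature.csingularChainComplex R M X` of `…SingularChainsConcrete` (chains are finitely supported
functions `SingularSimplex X n →₀ M`) a homomorphism of coefficient modules `f : M →ₗ[R] N`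
acts coefficientwise (`Finsupp.mapRange`), and a short exact sequence of coefficient modules
`0 → M → N → P → 0` gives a short exact sequence of chain complexes
`0 → C_•(X; M) → C_•(X; N) → C_•(X; P) → 0`, "because `Cₙ(X; -) = ⨁_σ (-)` is exact"
(A. Hatcher, *Algebraic Topology*, CUP 2002, §2.2 p. 153 and §3.E p. 303: the Bockstein long
exact sequence). Everything is proved:

* `Literature.AlgebraicTopology.SingularHomology.csingularSMod.mapCoeff`, `Literature.csingularChainComplex.mapCoeff X f : C_•(X; M) ⟶ C_•(X; N)`
  (`mapCoeff_f_apply`, `mapCoeff_f_single`, `mapCoeff_comp`, `mapCoeff_zsmul_id`);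
* `Literature.csingularChainComplex.coeffShortComplex X f g`, and
  **`coeffShortComplex_shortExact`**: it is short exact when `0 → M →ᶠ N →ᵍ P → 0` is
  (Hatcher 2002, §3.E, p. 303) — the concrete-model form of the named fact
  `Literature.AlgebraicTopology.SingularHomology.shortExact_mapCoeff` of `…Coefficients` (which concerns Mathlib's coproduct model and is
  not discharged here);
* **`Literature.AlgebraicTopology.SingularHomology.csingularHomology.zsmul_right_injective_of_isZero`** (integral Bockstein criterion):
  if `Hₖ₊₁(X; ℤ/d) = 0`, `d ≥ 1`, then multiplication by `d` is injective on `Hₖ(X; ℤ)` — the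
  segment `Hₖ₊₁(X; ℤ/d) →β Hₖ(X; ℤ) →(d·) Hₖ(X; ℤ)` of the Bockstein sequence of
  `0 → ℤ →(d·) ℤ → ℤ/d → 0` is exact (Hatcher 2002, §3.E, p. 303); and its transport
  `Literature.AlgebraicTopology.SingularHomology.singularHomology.zsmul_right_injective_of_isZero` to Mathlib's singular homology
  `Literature.AlgebraicTopology.SingularHomology.singularHomology` along the comparison isomorphism `csingularHomology.compIso`;
* `Literature.AlgebraicTopology.SingularHomology.subsingleton_of_zsmul_eq_zero_of_injective`: a `ℤ`-module killed by `d ≠ 0` on which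
  `d·` is injective is trivial (the form in which the criterion is consumed: a torsion group
  without `d`-torsion).

## References

* A. Hatcher, *Algebraic Topology*, CUP 2002, §2.2 (p. 153), §3.E (p. 303). [HatcherAT2002]

## Design notes

* As in `…SingularChainsConcrete`, `backward.isDefEq.respectTransparency` is turned off (chains
  of the concrete complex are `Finsupp`s up to unfolding).
* No declaration in this file uses `sorry`; no named facts are introduced.
-/

noncomputable section

-- as in `SingularChainsConcrete`: chains of the concrete complex are `Finsupp`s up to unfolding
set_option backward.isDefEq.respectTransparency false

open CategoryTheory Limits AlgebraicTopology Simplicial Opposite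

universe u v

namespace Literature.AlgebraicTopology.SingularHomology

variable {R : Type v} [CommRing R]
variable {M N P : Type v} [AddCommGroup M] [Module R M] [AddCommGroup N] [Module R N]
  [AddCommGroup P] [Module R P]
variable {X : Type u} [TopologicalSpace X]

/-! ### Change of coefficients on the concrete simplicial module and chain complex -/

namespace csingularSMod

variable (X) in
/-- The morphism of concrete simplicial chain modules induced by a homomorphism of coefficient
modules `f : M →ₗ[R] N`: coefficientwise application of `f` (`Finsupp.mapRange`), which commutes
with the push-forward of simplices (Hatcher 2002, §2.2, p. 153). [cite: HatcherAT2002, §2.2 p. 153] -/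
def mapCoeff (f : M →ₗ[R] N) : csingularSMod R M X ⟶ csingularSMod R N X where
  app n := ModuleCat.ofHom (Finsupp.mapRange.linearMap f)
  naturality n m θ := by
    dsimp only [csingularSMod]
    apply ModuleCat.hom_ext
    refine Finsupp.lhom_ext (fun σ x => ?_)
    rw [ModuleCat.hom_comp, ModuleCat.hom_comp, LinearMap.comp_apply, LinearMap.comp_apply,
      ModuleCat.hom_ofHom, ModuleCat.hom_ofHom, ModuleCat.hom_ofHom, ModuleCat.hom_ofHom,
      Finsupp.lmapDomain_apply, Finsupp.mapDomain_single, Finsupp.mapRange.linearMap_apply,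
      Finsupp.mapRange.linearMap_apply, Finsupp.mapRange_single, Finsupp.mapRange_single,
      Finsupp.lmapDomain_apply, Finsupp.mapDomain_single]

/-- `mapCoeff f` on an elementary chain: `m • σ ↦ f m • σ` (Hatcher 2002, §2.2). [cite: HatcherAT2002, §2.2 p. 153] -/
lemma mapCoeff_app_hom_single (f : M →ₗ[R] N) {n : ℕ} (σ : SingularSimplex X n) (m : M) :
    ((mapCoeff X f).app (op ⦋n⦌)).hom (Finsupp.single σ m) = Finsupp.single σ (f m) :=
  Finsupp.mapRange_single (hf := map_zero f)

end csingularSMod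

namespace csingularChainComplex

variable (X) in
/-- The chain map `f♯ : C_•(X; M) ⟶ C_•(X; N)` of concrete singular chains induced by a
homomorphism of coefficient modules `f : M →ₗ[R] N`, `∑ mᵢ σᵢ ↦ ∑ f(mᵢ) σᵢ` (Hatcher 2002,
§2.2, p. 153). [cite: HatcherAT2002, §2.2 p. 153] -/
def mapCoeff (f : M →ₗ[R] N) : csingularChainComplex R M X ⟶ csingularChainComplex R N X :=
  AlternatingFaceMapComplex.map (csingularSMod.mapCoeff X f)

/-- `mapCoeff f` is `Finsupp.mapRange f` degreewise. [folklore] -/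
lemma mapCoeff_f_apply (f : M →ₗ[R] N) {n : ℕ} (c : (csingularChainComplex R M X).X n) :
    (mapCoeff X f).f n c = (Finsupp.mapRange f (map_zero f) c : CChain N X n) := rfl

/-- `mapCoeff f` on an elementary chain (Hatcher 2002, §2.2). [cite: HatcherAT2002, §2.2 p. 153] -/
lemma mapCoeff_f_single (f : M →ₗ[R] N) {n : ℕ} (σ : SingularSimplex X n) (m : M) :
    (mapCoeff X f).f n (Finsupp.single σ m) = (Finsupp.single σ (f m) : CChain N X n) :=
  Finsupp.mapRange_single (hf := map_zero f)

/-- Functoriality of `mapCoeff` in the coefficient homomorphism (Hatcher 2002, §2.2). [folklore] -/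
lemma mapCoeff_comp (f : M →ₗ[R] N) (g : N →ₗ[R] P) :
    mapCoeff X (g ∘ₗ f) = mapCoeff X f ≫ mapCoeff X g := by
  ext n : 1
  apply ModuleCat.hom_ext
  refine Finsupp.lhom_ext (fun σ m => ?_)
  change (mapCoeff X (g ∘ₗ f)).f n (Finsupp.single σ m) =
    (mapCoeff X g).f n ((mapCoeff X f).f n (Finsupp.single σ m))
  rw [mapCoeff_f_single, mapCoeff_f_single, mapCoeff_f_single, LinearMap.comp_apply]

/-- Change of coefficients along `d • id` is multiplication by `d` on the chain complex. [folklore] -/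
lemma mapCoeff_zsmul_id (d : ℤ) :
    mapCoeff X (d • (LinearMap.id : M →ₗ[R] M)) = d • 𝟙 (csingularChainComplex R M X) := by
  ext n : 1
  apply ModuleCat.hom_ext
  refine Finsupp.lhom_ext (fun σ m => ?_)
  change (mapCoeff X (d • (LinearMap.id : M →ₗ[R] M))).f n (Finsupp.single σ m) =
    ((d • 𝟙 (csingularChainComplex R M X)).f n).hom (Finsupp.single σ m)
  rw [mapCoeff_f_single, HomologicalComplex.zsmul_f_apply, ModuleCat.hom_zsmul,
    LinearMap.smul_apply, HomologicalComplex.id_f, ModuleCat.hom_id, LinearMap.id_apply,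
    LinearMap.smul_apply, LinearMap.id_apply, Finsupp.smul_single]

/-! ### Short exact sequences of coefficients -/

variable (X) in
/-- The short complex of concrete singular chain complexes `C_•(X; M) ⟶ C_•(X; N) ⟶ C_•(X; P)`
induced by coefficient homomorphisms `M →ᶠ N →ᵍ P` with `g ∘ f = 0` (Hatcher 2002, §3.E,
p. 303). [cite: HatcherAT2002, §3.E p. 303] -/
def coeffShortComplex (f : M →ₗ[R] N) (g : N →ₗ[R] P) (hfg : g ∘ₗ f = 0) :
    ShortComplex (ChainComplex (ModuleCat.{max u v} R) ℕ) :=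
  ShortComplex.mk (mapCoeff X f) (mapCoeff X g) (by
    rw [← mapCoeff_comp, hfg]
    ext n : 1
    apply ModuleCat.hom_ext
    refine Finsupp.lhom_ext (fun σ m => ?_)
    change (mapCoeff X (0 : M →ₗ[R] P)).f n (Finsupp.single σ m) = 0
    rw [mapCoeff_f_single, LinearMap.zero_apply, Finsupp.single_zero])

/-- **A short exact sequence of coefficient modules induces a short exact sequence of singular
chain complexes** `0 → C_•(X; M) → C_•(X; N) → C_•(X; P) → 0`: degreewise these are direct sums
of copies of `0 → M → N → P → 0` (Hatcher 2002, §3.E, p. 303, and §2.2 p. 153).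
[cite: HatcherAT2002, §3.E p. 303] -/
theorem coeffShortComplex_shortExact (f : M →ₗ[R] N) (g : N →ₗ[R] P) (hfg : Function.Exact f g)
    (hf : Function.Injective f) (hg : Function.Surjective g) :
    (coeffShortComplex X f g hfg.linearMap_comp_eq_zero).ShortExact := by
  refine HomologicalComplex.shortExact_of_degreewise_shortExact _ (fun n => ?_)
  refine ShortComplex.ShortExact.mk' ?_ ?_ ?_
  · rw [ShortComplex.moduleCat_exact_iff]
    intro c hc
    -- `c` is a chain with coefficients in `N` killed by `g`; lift it coefficientwise
    change CChain N X n at c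
    change (mapCoeff X g).f n c = 0 at hc
    rw [mapCoeff_f_apply] at hc
    have hmem : (c : CChain N X n) ∈ Set.range (Finsupp.mapRange (α := SingularSimplex X n) f
        (map_zero f)) := by
      rw [Finsupp.range_mapRange]
      intro σ
      have h1 : g (c σ) = 0 := by
        have := congrArg (fun e : CChain P X n => e σ) hc
        simpa only [Finsupp.mapRange_apply, Finsupp.coe_zero, Pi.zero_apply] using this
      exact (hfg (c σ)).mp h1
    obtain ⟨c', hc'⟩ := hmem
    exact ⟨c', hc'⟩
  · change Mono (ModuleCat.ofHom (Finsupp.mapRange.linearMap (α := SingularSimplex X n) f))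
    rw [ModuleCat.mono_iff_injective]
    exact Finsupp.mapRange_injective f (map_zero f) hf
  · change Epi (ModuleCat.ofHom (Finsupp.mapRange.linearMap (α := SingularSimplex X n) g))
    rw [ModuleCat.epi_iff_surjective]
    exact Finsupp.mapRange_surjective g (map_zero g) hg

end csingularChainComplex

/-! ### The integral Bockstein criterion -/

/-- The coefficient sequence `ℤ →(d·) ℤ → ℤ/d → 0` is exact in the middle (Hatcher 2002, §3.E,
the example `ℤ → ℤ → ℤ/p`). [folklore] -/
theorem Int.exact_zsmul_cast_zmod (d : ℕ) :
    Function.Exact ((d : ℤ) • (LinearMap.id : ℤ →ₗ[ℤ] ℤ))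
      (Int.castAddHom (ZMod d)).toIntLinearMap := by
  intro y
  change ((y : ℤ) : ZMod d) = 0 ↔ y ∈ Set.range fun a : ℤ => (d : ℤ) • a
  rw [ZMod.intCast_zmod_eq_zero_iff_dvd]
  constructor
  · rintro ⟨a, rfl⟩
    exact ⟨a, by simp⟩
  · rintro ⟨a, rfl⟩
    exact ⟨a, by simp⟩

/-- **Integral Bockstein criterion** (concrete singular homology). If `Hₖ₊₁(X; ℤ/d) = 0` with
`d ≥ 1`, then multiplication by `d` is injective on `Hₖ(X; ℤ)`: in the long exact sequence of
`0 → C_•(X; ℤ) →(d·) C_•(X; ℤ) → C_•(X; ℤ/d) → 0` the segment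
`Hₖ₊₁(X; ℤ/d) →β Hₖ(X; ℤ) →(d·) Hₖ(X; ℤ)` is exact (Hatcher 2002, §3.E, p. 303).
[cite: HatcherAT2002, §3.E p. 303] -/
theorem csingularHomology.zsmul_right_injective_of_isZero {d : ℕ} (hd : 0 < d) (k : ℕ)
    (hZ : IsZero (csingularHomology ℤ (ZMod d) X (k + 1))) :
    Function.Injective fun x : csingularHomology ℤ ℤ X k => (d : ℤ) • x := by
  have hfg := Int.exact_zsmul_cast_zmod d
  have hf : Function.Injective ((d : ℤ) • (LinearMap.id : ℤ →ₗ[ℤ] ℤ)) := by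
    intro a b h
    have h' : (d : ℤ) * a = (d : ℤ) * b := by simpa [smul_eq_mul] using h
    exact mul_left_cancel₀ (by exact_mod_cast hd.ne') h'
  have hg : Function.Surjective (Int.castAddHom (ZMod d)).toIntLinearMap :=
    ZMod.intCast_surjective
  have hS := csingularChainComplex.coeffShortComplex_shortExact (X := X) _ _ hfg hf hg
  have hδ : hS.δ (k + 1) k rfl = 0 := hZ.eq_of_src _ _
  have hmono := (hS.homology_exact₁ (k + 1) k rfl).mono_g hδ
  -- the map `Hₖ(d • 𝟙) = d • 𝟙`
  have hmap : HomologicalComplex.homologyMap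
      (csingularChainComplex.coeffShortComplex X ((d : ℤ) • (LinearMap.id : ℤ →ₗ[ℤ] ℤ))
        (Int.castAddHom (ZMod d)).toIntLinearMap hfg.linearMap_comp_eq_zero).f k =
      (d : ℤ) • 𝟙 (csingularHomology ℤ ℤ X k) := by
    change (HomologicalComplex.homologyFunctor _ _ k).map
      (csingularChainComplex.mapCoeff X ((d : ℤ) • (LinearMap.id : ℤ →ₗ[ℤ] ℤ))) = _
    rw [csingularChainComplex.mapCoeff_zsmul_id, Functor.map_zsmul, CategoryTheory.Functor.map_id]
    rfl
  change Mono (HomologicalComplex.homologyMap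
      (csingularChainComplex.coeffShortComplex X ((d : ℤ) • (LinearMap.id : ℤ →ₗ[ℤ] ℤ))
        (Int.castAddHom (ZMod d)).toIntLinearMap hfg.linearMap_comp_eq_zero).f k) at hmono
  rw [hmap, ModuleCat.mono_iff_injective] at hmono
  intro x y hxy
  apply hmono
  change ((d : ℤ) • 𝟙 (csingularHomology ℤ ℤ X k)).hom x =
    ((d : ℤ) • 𝟙 (csingularHomology ℤ ℤ X k)).hom y
  rw [ModuleCat.hom_zsmul, ModuleCat.hom_id]
  exact hxy

/-- **Integral Bockstein criterion** for Mathlib's singular homology (`Literature.AlgebraicTopology.SingularHomology.singularHomology`),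
transported along the comparison isomorphism `csingularHomology.compIso`: if
`Hₖ₊₁(X; ℤ/d) = 0`, `d ≥ 1`, then multiplication by `d` is injective on `Hₖ(X; ℤ)`
(Hatcher 2002, §3.E, p. 303). [cite: HatcherAT2002, §3.E p. 303] -/
theorem singularHomology.zsmul_right_injective_of_isZero {d : ℕ} (hd : 0 < d) (k : ℕ)
    (hZ : IsZero (singularHomology ℤ (ZMod d) X (k + 1))) :
    Function.Injective fun x : singularHomology ℤ ℤ X k => (d : ℤ) • x := by
  have hZ' : IsZero (csingularHomology ℤ (ZMod d) X (k + 1)) :=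
    hZ.of_iso (csingularHomology.compIso ℤ (ZMod d) X (k + 1))
  have hinj := csingularHomology.zsmul_right_injective_of_isZero hd k hZ'
  let e := csingularHomology.compIso ℤ ℤ X k
  intro x y hxy
  dsimp only at hxy
  have h' : (d : ℤ) • e.inv x = (d : ℤ) • e.inv y := by
    have := congrArg (fun z => e.inv z) hxy
    simpa only [map_zsmul] using this
  have hx' : e.inv x = e.inv y := hinj h'
  calc x = e.hom (e.inv x) := (e.inv_hom_id_apply x).symm
    _ = e.hom (e.inv y) := by rw [hx']
    _ = y := e.inv_hom_id_apply y

/-- **A torsion module without `d`-torsion is trivial**: if `d • t = 0` for all `t` and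
multiplication by `d` is injective, the module is a subsingleton (the form in which the Bockstein
criterion is used: `Hₖ` is shown to be killed by some `d ≠ 0` by a Mayer–Vietoris argument and
to have no `d`-torsion by `zsmul_right_injective_of_isZero`). [folklore] -/
theorem subsingleton_of_zsmul_eq_zero_of_injective {A : Type*} [AddCommGroup A] {d : ℤ}
    (hkill : ∀ t : A, d • t = 0) (hinj : Function.Injective fun t : A => d • t) :
    Subsingleton A := by
  refine ⟨fun a b => hinj ?_⟩
  simp only [hkill]

end Literature.AlgebraicTopology.SingularHomology

end
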